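import Literature.Analysis.FluidPDE.NSFourierSynthesis
import HarnessLib

/-!
# Dominated Fourier families and their synthesis on the closed slab

Sixteenth file of the weighted-`L²` Fourier-side construction of the local smooth solution of
the Navier–Stokes system with `H¹`-controlled lifespan (discharge of
`Literature.Analysis.FluidPDE.tao2011_fourier_local_existence`; Tao 2013, Thm. 5.4 (ii)+(iv)).

The tree's synthesis theory (`NSFourierFamily`, `NSFourierSynthesis`) proves that
`(t, x) ↦ 𝓕 (W₀ t) x` is jointly `C^∞` on `[0, T] × E` for *Fourier families* `W₀, W₁, …`
(`IsFourierFamily`: time slices with **pointwise** polynomial decay `‖W_k(t, ξ)‖ ≤ C(1+‖ξ‖)^{-K}`).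
The Fourier-side solution `v = h - E` of Tao's theorem has a rough free part
`h(t, ξ) = e^{-c‖ξ‖² t} a(ξ)` with `a` merely weighted square integrable, so its time-derivative
family `(-c‖ξ‖²)^k h` is not a Fourier family. This file introduces the weaker class actually
needed by the dominated-convergence arguments and re-proves the synthesis theorems for it:

* `IsDomFourierFamily T n W` — measurable slices; **for every order `K` a time-independent
  square-integrable dominator** `(1+‖ξ‖)^K ‖W_k(t, ξ)‖ ≤ g_K(ξ)`, `g_K ∈ L²`, for `t ∈ [0, T]`;
  continuity in `t` and `∂ₜ W_k = W_{k+1}` within `[0, T]` at each frequency. Fourier families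
  are dominated families (`IsFourierFamily.isDom`), and so is the free family of an
  `IsSobolevFourierDatum` (later file). In dimension `< 4` the dominators are also integrable
  against every polynomial weight (`IsDomFourierFamily.exists_integrable_dom`, Cauchy–Schwarz
  with `(1+‖ξ‖)^{-2} ∈ L²`).
* the algebra `mono`, `shift`, `add`, `neg`, `sub`, `symbol`, `const_mul`, `finset_sum`, `dmul`;
* the synthesis on the slab: `continuousOn_synth`, `hasFDerivWithinAt_synth`,
  `fderivWithin_synth_apply`, `contDiffOn_synth`, `contDiffOn_synth_infty`,
  `hasDerivWithinAt_synth_time` (the proofs of `NSFourierSynthesis` with the decay bounds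
  replaced by the integrable dominators).

## References

* J. Leray, Acta Math. 63 (1934), §19, pp. 220–221 (derivatives of the regular solution are
  continuous on the closed interval). [Leray1934]
* T. Tao, Anal. PDE 6 (2013) = arXiv:1108.1165, Thm. 5.4 (iv) and the note closing its proof
  ("it would have sufficed to have `u₀ ∈ H^k_x(ℝ³)` … for all `j, k ≥ 0`"). [Tao2011]
-/

noncomputable section

open MeasureTheory Real Set Filter Topology Function Complex
open scoped FourierTransform RealInnerProductSpace ContDiff ENNReal

namespace Literature.Analysis.FluidPDE.FourierNS

variable {ι : Type*} [Fintype ι]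

/-- **Dominated Fourier families** on `[0, T]` of order `n`: `W₀, …, W_n : ℝ → E → ℂ` with
measurable time slices, **time-independent square-integrable dominators of every polynomial
order** (`(1+‖ξ‖)^K ‖W_k(t,ξ)‖ ≤ g_K(ξ)` on `[0, T]`, `g_K ∈ L²(E)`), continuity in `t ∈ [0, T]`
at each frequency, and `∂ₜ W_k = W_{k+1}` within `[0, T]` (`k < n`). This is the Fourier-side
content of "`∂ₜᵏ u(t) ∈ H^K` for all `k, K`, uniformly on `[0, T]`" for `u(t) = 𝓕 W₀(t)`
(Tao 2013, Thm. 5.4 (iv): `∂ₜʲu ∈ L^∞_t H^k`), the weighted-`L²` analogue of the tree's pointwise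
class `IsFourierFamily`. [folklore] -/
structure IsDomFourierFamily (T : ℝ) (n : ℕ) (W : ℕ → ℝ → EuclideanSpace ℝ ι → ℂ) : Prop where
  /-- measurable time slices on `[0, T]` -/
  meas : ∀ k ≤ n, ∀ t ∈ Icc 0 T, AEStronglyMeasurable (W k t) volume
  /-- square-integrable dominators of every polynomial order, uniformly on `[0, T]` -/
  dom : ∀ k ≤ n, ∀ K : ℕ, ∃ g : EuclideanSpace ℝ ι → ℝ, MemLp g 2 volume ∧
    ∀ t ∈ Icc 0 T, ∀ ξ, (1 + ‖ξ‖) ^ K * ‖W k t ξ‖ ≤ g ξ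
  /-- continuity in time on `[0, T]` at each frequency -/
  cont : ∀ k ≤ n, ∀ ξ, ContinuousOn (fun t => W k t ξ) (Icc 0 T)
  /-- `∂ₜ W_k = W_{k+1}` within `[0, T]` -/
  deriv : ∀ k < n, ∀ ξ, ∀ t ∈ Icc 0 T, HasDerivWithinAt (fun s => W k s ξ) (W (k + 1) t ξ) (Icc 0 T) t

variable {T : ℝ} {n : ℕ} {W W' : ℕ → ℝ → EuclideanSpace ℝ ι → ℂ}

/-- The inverse weight `(1+‖ξ‖)^{-m}` is square integrable when `2m > dim`. [folklore] -/
theorem memLp_two_inv_one_add_norm_pow {m : ℕ} (hm : Module.finrank ℝ (EuclideanSpace ℝ ι) < 2 * m) :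
    MemLp (fun ξ : EuclideanSpace ℝ ι => ((1 + ‖ξ‖) ^ m)⁻¹) 2 volume := by
  rw [memLp_two_iff_integrable_sq (continuous_inv_one_add_norm_pow m).aestronglyMeasurable]
  refine (integrable_inv_one_add_norm_pow (E := EuclideanSpace ℝ ι) hm).congr
    (Eventually.of_forall fun ξ => ?_)
  simp only [pow_mul', inv_pow]

namespace IsDomFourierFamily

/-- Restriction to fewer derivatives. [folklore] -/
theorem mono (h : IsDomFourierFamily T n W) {m : ℕ} (hm : m ≤ n) : IsDomFourierFamily T m W where
  meas k hk := h.meas k (hk.trans hm)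
  dom k hk := h.dom k (hk.trans hm)
  cont k hk := h.cont k (hk.trans hm)
  deriv k hk := h.deriv k (lt_of_lt_of_le hk hm)

/-- **Shift**: the family of `∂ₜ W₀ = W₁`. [folklore] -/
theorem shift (h : IsDomFourierFamily T (n + 1) W) : IsDomFourierFamily T n (fun k => W (k + 1)) where
  meas k hk := h.meas (k + 1) (by omega)
  dom k hk := h.dom (k + 1) (by omega)
  cont k hk := h.cont (k + 1) (by omega)
  deriv k hk := h.deriv (k + 1) (by omega)

/-- Sums of dominated families. [folklore] -/
theorem add (h : IsDomFourierFamily T n W) (h' : IsDomFourierFamily T n W') :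
    IsDomFourierFamily T n (fun k t ξ => W k t ξ + W' k t ξ) where
  meas k hk t ht := (h.meas k hk t ht).add (h'.meas k hk t ht)
  dom k hk K := by
    obtain ⟨g, hg, hb⟩ := h.dom k hk K
    obtain ⟨g', hg', hb'⟩ := h'.dom k hk K
    refine ⟨fun ξ => g ξ + g' ξ, hg.add hg', fun t ht ξ => ?_⟩
    calc (1 + ‖ξ‖) ^ K * ‖W k t ξ + W' k t ξ‖ ≤ (1 + ‖ξ‖) ^ K * (‖W k t ξ‖ + ‖W' k t ξ‖) :=
          mul_le_mul_of_nonneg_left (norm_add_le _ _) (by positivity)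
      _ ≤ g ξ + g' ξ := by rw [mul_add]; exact add_le_add (hb t ht ξ) (hb' t ht ξ)
  cont k hk ξ := (h.cont k hk ξ).add (h'.cont k hk ξ)
  deriv k hk ξ t ht := (h.deriv k hk ξ t ht).add (h'.deriv k hk ξ t ht)

/-- Negation. [folklore] -/
theorem neg (h : IsDomFourierFamily T n W) : IsDomFourierFamily T n (fun k t ξ => -W k t ξ) where
  meas k hk t ht := (h.meas k hk t ht).neg
  dom k hk K := by
    obtain ⟨g, hg, hb⟩ := h.dom k hk K
    exact ⟨g, hg, fun t ht ξ => by rw [norm_neg]; exact hb t ht ξ⟩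
  cont k hk ξ := (h.cont k hk ξ).neg
  deriv k hk ξ t ht := (h.deriv k hk ξ t ht).neg

/-- Differences. [folklore] -/
theorem sub (h : IsDomFourierFamily T n W) (h' : IsDomFourierFamily T n W') :
    IsDomFourierFamily T n (fun k t ξ => W k t ξ - W' k t ξ) := by
  simpa [sub_eq_add_neg] using h.add h'.neg

/-- **Multiplication by a time-independent symbol of polynomial growth** (`-2πi⟪ξ, h⟫`,
`-c‖ξ‖²`, …). [folklore] -/
theorem symbol (h : IsDomFourierFamily T n W) {m : EuclideanSpace ℝ ι → ℂ}
    (hm : AEStronglyMeasurable m volume) {d : ℕ} {M : ℝ} (hM : 0 ≤ M)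
    (hgrowth : ∀ ξ, ‖m ξ‖ ≤ M * (1 + ‖ξ‖) ^ d) :
    IsDomFourierFamily T n (fun k t ξ => m ξ * W k t ξ) where
  meas k hk t ht := hm.mul (h.meas k hk t ht)
  dom k hk K := by
    obtain ⟨g, hg, hb⟩ := h.dom k hk (K + d)
    refine ⟨fun ξ => M * g ξ, hg.const_mul M, fun t ht ξ => ?_⟩
    calc (1 + ‖ξ‖) ^ K * ‖m ξ * W k t ξ‖ = ‖m ξ‖ * ((1 + ‖ξ‖) ^ K * ‖W k t ξ‖) := by
          rw [norm_mul]; ring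
      _ ≤ M * (1 + ‖ξ‖) ^ d * ((1 + ‖ξ‖) ^ K * ‖W k t ξ‖) :=
          mul_le_mul_of_nonneg_right (hgrowth ξ) (by positivity)
      _ = M * ((1 + ‖ξ‖) ^ (K + d) * ‖W k t ξ‖) := by rw [pow_add]; ring
      _ ≤ M * g ξ := mul_le_mul_of_nonneg_left (hb t ht ξ) hM
  cont k hk ξ := continuousOn_const.mul (h.cont k hk ξ)
  deriv k hk ξ t ht := by
    simpa using (h.deriv k hk ξ t ht).const_mul (m ξ)

/-- Constant multiples. [folklore] -/
theorem const_mul (h : IsDomFourierFamily T n W) (c : ℂ) :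
    IsDomFourierFamily T n (fun k t ξ => c * W k t ξ) :=
  h.symbol (m := fun _ => c) aestronglyMeasurable_const (d := 0) (norm_nonneg c) (fun ξ => by simp)

/-- The zero family. [folklore] -/
theorem zero (T : ℝ) (n : ℕ) : IsDomFourierFamily T n (fun _ _ (_ : EuclideanSpace ℝ ι) => (0 : ℂ)) where
  meas k hk t ht := aestronglyMeasurable_const
  dom k hk K := ⟨fun _ => 0, MemLp.zero', fun t ht ξ => by simp⟩
  cont k hk ξ := continuousOn_const
  deriv k hk ξ t ht := hasDerivWithinAt_const t (Icc 0 T) (0 : ℂ)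

/-- Finite sums of dominated families. [folklore] -/
theorem finset_sum {β : Type*} (s : Finset β) {Wf : β → ℕ → ℝ → EuclideanSpace ℝ ι → ℂ}
    (h : ∀ b ∈ s, IsDomFourierFamily T n (Wf b)) :
    IsDomFourierFamily T n (fun k t ξ => ∑ b ∈ s, Wf b k t ξ) := by
  classical
  induction s using Finset.induction_on with
  | empty => simpa using zero (ι := ι) T n
  | insert b s hb ih =>
    have h1 := (h b (Finset.mem_insert_self b s)).add (ih fun b' hb' => h b' (Finset.mem_insert_of_mem hb'))
    simpa [Finset.sum_insert hb] using h1

/-- The space-derivative family of a dominated family is dominated. [folklore] -/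
theorem dmul (hW : IsDomFourierFamily T n W) (h : EuclideanSpace ℝ ι) :
    IsDomFourierFamily T n (FourierNS.dmul h W) :=
  hW.symbol (m := fun ξ => -(2 * π * I) * (⟪ξ, h⟫ : ℂ))
    (by fun_prop : Continuous fun ξ : EuclideanSpace ℝ ι => -(2 * π * I) * (⟪ξ, h⟫ : ℂ)).aestronglyMeasurable
    (d := 1) (M := 2 * π * ‖h‖) (by positivity) (norm_dmulSymbol_le h)

/-! ### Integrable dominators (dimension `< 2m`) -/

/-- **Integrable dominators**: in dimension `< 2m`, a dominated family has, for every order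
`K`, a time-independent *integrable* dominator of `(1+‖ξ‖)^K ‖W_k(t, ξ)‖` (the square-integrable
dominator of order `K + m` times `(1+‖ξ‖)^{-m} ∈ L²`, Cauchy–Schwarz). [folklore] -/
theorem exists_integrable_dom (h : IsDomFourierFamily T n W) {m : ℕ}
    (hm : Module.finrank ℝ (EuclideanSpace ℝ ι) < 2 * m) {k : ℕ} (hk : k ≤ n) (K : ℕ) :
    ∃ b : EuclideanSpace ℝ ι → ℝ, Integrable b ∧ ∀ t ∈ Icc 0 T, ∀ ξ, (1 + ‖ξ‖) ^ K * ‖W k t ξ‖ ≤ b ξ := by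
  obtain ⟨g, hg, hb⟩ := h.dom k hk (K + m)
  refine ⟨fun ξ => g ξ * ((1 + ‖ξ‖) ^ m)⁻¹,
    MemLp.integrable_mul (p := 2) (q := 2) hg (memLp_two_inv_one_add_norm_pow hm), fun t ht ξ => ?_⟩
  have hpos : (0 : ℝ) < (1 + ‖ξ‖) ^ m := by positivity
  rw [le_mul_inv_iff₀ hpos]
  calc (1 + ‖ξ‖) ^ K * ‖W k t ξ‖ * (1 + ‖ξ‖) ^ m = (1 + ‖ξ‖) ^ (K + m) * ‖W k t ξ‖ := by
        rw [pow_add]; ring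
    _ ≤ g ξ := hb t ht ξ

/-- Integrability of the polynomial moments `‖ξ‖^K ‖W_k(t, ξ)‖` of the slices on `[0, T]`
(dimension `< 2m` witnessed by `hm`). [folklore] -/
theorem integrable_pow_mul_norm (h : IsDomFourierFamily T n W) {m : ℕ}
    (hm : Module.finrank ℝ (EuclideanSpace ℝ ι) < 2 * m) {k : ℕ} (hk : k ≤ n) (K : ℕ)
    {t : ℝ} (ht : t ∈ Icc 0 T) :
    Integrable (fun ξ : EuclideanSpace ℝ ι => ‖ξ‖ ^ K * ‖W k t ξ‖) := by
  obtain ⟨b, hb, hbd⟩ := h.exists_integrable_dom hm hk K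
  refine hb.mono' ((continuous_norm.pow K).aestronglyMeasurable.mul (h.meas k hk t ht).norm)
    (Eventually.of_forall fun ξ => ?_)
  rw [Real.norm_eq_abs, abs_of_nonneg (by positivity)]
  calc ‖ξ‖ ^ K * ‖W k t ξ‖ ≤ (1 + ‖ξ‖) ^ K * ‖W k t ξ‖ :=
        mul_le_mul_of_nonneg_right (pow_le_pow_left₀ (norm_nonneg _) (by linarith [norm_nonneg ξ]) K)
          (norm_nonneg _)
    _ ≤ b ξ := hbd t ht ξ

/-- Integrability of the slices on `[0, T]` (dimension `< 2m`). [folklore] -/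
theorem integrable (h : IsDomFourierFamily T n W) {m : ℕ}
    (hm : Module.finrank ℝ (EuclideanSpace ℝ ι) < 2 * m) {k : ℕ} (hk : k ≤ n)
    {t : ℝ} (ht : t ∈ Icc 0 T) : Integrable (W k t) := by
  have h1 := h.integrable_pow_mul_norm hm hk 0 ht
  simp only [pow_zero, one_mul] at h1
  exact h1.congr' (h.meas k hk t ht) (Eventually.of_forall fun ξ => norm_norm _)

end IsDomFourierFamily

/-- **Fourier families are dominated families**: pointwise decay of order `K + m`,
`2m > dim`, gives the square-integrable dominator `C (1+‖ξ‖)^{-m}` of order `K`. [folklore] -/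
theorem IsFourierFamily.isDom {m : ℕ} (hm : Module.finrank ℝ (EuclideanSpace ℝ ι) < 2 * m)
    (h : IsFourierFamily T n W) : IsDomFourierFamily T n W where
  meas := h.meas
  dom k hk K := by
    obtain ⟨C, hC⟩ := h.decay k hk (K + m)
    refine ⟨fun ξ => C * ((1 + ‖ξ‖) ^ m)⁻¹, (memLp_two_inv_one_add_norm_pow hm).const_mul C,
      fun t ht ξ => ?_⟩
    have hpos : (0 : ℝ) < (1 + ‖ξ‖) ^ m := by positivity
    have hposK : (0 : ℝ) < (1 + ‖ξ‖) ^ (K + m) := by positivity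
    have h1 := hC t ht ξ
    rw [← div_eq_mul_inv, le_div_iff₀ hposK] at h1
    show (1 + ‖ξ‖) ^ K * ‖W k t ξ‖ ≤ C * ((1 + ‖ξ‖) ^ m)⁻¹
    rw [← div_eq_mul_inv, le_div_iff₀ hpos]
    calc (1 + ‖ξ‖) ^ K * ‖W k t ξ‖ * (1 + ‖ξ‖) ^ m = ‖W k t ξ‖ * (1 + ‖ξ‖) ^ (K + m) := by
          rw [pow_add]; ring
      _ ≤ C := h1
  cont := h.cont
  deriv := h.deriv


/-! ### Synthesis of dominated families on the closed slab -/

namespace IsDomFourierFamily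

/-- **Joint continuity** of the synthesized field on the closed slab `[0, T] × E` for a dominated
family (dominated convergence with the integrable dominator of order `0`; dimension `< 2m`).
[folklore] -/
theorem continuousOn_synth {m : ℕ} (hm : Module.finrank ℝ (EuclideanSpace ℝ ι) < 2 * m)
    (hW : IsDomFourierFamily T n W) :
    ContinuousOn (synth W) (Icc 0 T ×ˢ univ) := by
  obtain ⟨b, hb, hbd⟩ := hW.exists_integrable_dom hm (Nat.zero_le _) 0
  have hsynth : synth W = fun z => ∫ ξ, 𝐞 (-⟪ξ, z.2⟫) • W 0 z.1 ξ := funext (synth_eq W)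
  rw [hsynth]
  refine continuousOn_of_dominated (bound := b) ?_ ?_ hb ?_
  · intro z hz
    exact (Continuous.aestronglyMeasurable (by fun_prop)).smul (hW.meas 0 (Nat.zero_le _) z.1 hz.1)
  · intro z hz
    refine Eventually.of_forall fun ξ => ?_
    rw [Circle.norm_smul]
    have h := hbd z.1 hz.1 ξ
    rwa [pow_zero, one_mul] at h
  · refine Eventually.of_forall fun ξ => ?_
    have h1 : Continuous fun z : ℝ × EuclideanSpace ℝ ι => (𝐞 (-⟪ξ, z.2⟫) : ℂ) := by fun_prop
    have h2 : ContinuousOn (fun z : ℝ × EuclideanSpace ℝ ι => W 0 z.1 ξ) (Icc 0 T ×ˢ univ) :=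
      (hW.cont 0 (Nat.zero_le _) ξ).comp continuous_fst.continuousOn fun z hz => hz.1
    simp only [Circle.smul_def, smul_eq_mul]
    exact h1.continuousOn.mul h2

-- the dominated-differentiation step elaborates many continuous-linear-map coercions
set_option maxHeartbeats 800000 in
/-- **The joint derivative within the slab** of the synthesized field of a dominated family of
order `≥ 1` (dimension `< 2m`): at `z = (t, x) ∈ [0, T] × E` there is `L` with
`HasFDerivWithinAt (synth W) L ([0,T] × E) z` and
`L y = y.1 • synth (W₁, …) z + synth (dmul y.2 W) z` (differentiation under the integral sign of
the tangent-line extension in `t`, dominated by the integrable dominators of orders `0` and `1`;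
Leray 1934, pp. 220–221). [folklore] -/
theorem hasFDerivWithinAt_synth {m : ℕ} (hm : Module.finrank ℝ (EuclideanSpace ℝ ι) < 2 * m)
    (hT : 0 < T) (hW : IsDomFourierFamily T (n + 1) W)
    {z : ℝ × EuclideanSpace ℝ ι} (hz : z ∈ Icc 0 T ×ˢ univ) :
    ∃ L : ℝ × EuclideanSpace ℝ ι →L[ℝ] ℂ,
      HasFDerivWithinAt (synth W) L (Icc 0 T ×ˢ univ) z ∧
      ∀ y, L y = (y.1 : ℂ) * synth (fun k => W (k + 1)) z + synth (FourierNS.dmul y.2 W) z := by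
  have ht₀ : z.1 ∈ Icc 0 T := hz.1
  have h0 : 0 ≤ n + 1 := Nat.zero_le _
  have h1 : 1 ≤ n + 1 := by omega
  -- integrable dominators (orders `0` and `1`) of `W₀`, `W₁` on `[0, T]`
  obtain ⟨b₁, hb₁, hb₁d⟩ := hW.exists_integrable_dom hm h1 0
  obtain ⟨b₀', hb₀', hb₀'d⟩ := hW.exists_integrable_dom hm h0 1
  obtain ⟨b₁', hb₁', hb₁'d⟩ := hW.exists_integrable_dom hm h1 1
  -- the extended coefficient and its time derivative
  set Wt : ℝ → EuclideanSpace ℝ ι → ℂ := fun t ξ => icExtend T (W 0 · ξ) (W 1 · ξ) t with hWt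
  set Wt' : ℝ → EuclideanSpace ℝ ι → ℂ := fun t ξ => W 1 (clamp T t) ξ with hWt'
  have hWt_deriv : ∀ ξ t, HasDerivAt (Wt · ξ) (Wt' t ξ) t := fun ξ t =>
    hasDerivAt_icExtend hT (fun s hs => by simpa using hW.deriv 0 (by omega) ξ s hs) t
  -- the integrands
  set F : ℝ × EuclideanSpace ℝ ι → EuclideanSpace ℝ ι → ℂ :=
    fun zz ξ => (𝐞 (-⟪ξ, zz.2⟫) : ℂ) * Wt zz.1 ξ with hF
  set F' : ℝ × EuclideanSpace ℝ ι → EuclideanSpace ℝ ι → (ℝ × EuclideanSpace ℝ ι →L[ℝ] ℂ) :=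
    fun zz ξ => synthDerivCLM (𝐞 (-⟪ξ, zz.2⟫)) (Wt zz.1 ξ) (Wt' zz.1 ξ) ξ zz.2 with hF'
  have hF_diff : ∀ ξ zz, HasFDerivAt (F · ξ) (F' zz ξ) zz := fun ξ zz =>
    hasFDerivAt_char_mul ξ zz (hWt_deriv ξ zz.1)
  -- measurability of the slices
  have hWt_eq : ∀ t, (fun ξ => Wt t ξ) = W 0 (clamp T t) + (t - clamp T t) • W 1 (clamp T t) :=
    fun t => rfl
  have hWt_meas : ∀ t, AEStronglyMeasurable (fun ξ => Wt t ξ) volume := fun t => by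
    rw [hWt_eq]
    exact (hW.meas 0 h0 _ (clamp_mem_Icc hT.le t)).add
      ((hW.meas 1 h1 _ (clamp_mem_Icc hT.le t)).const_smul _)
  have hWt'_meas : ∀ t, AEStronglyMeasurable (fun ξ => Wt' t ξ) volume := fun t =>
    hW.meas 1 h1 _ (clamp_mem_Icc hT.le t)
  have hchar_cont : ∀ x : EuclideanSpace ℝ ι, Continuous fun ξ : EuclideanSpace ℝ ι =>
      (𝐞 (-⟪ξ, x⟫) : ℂ) := fun x => by fun_prop
  have hF_meas : ∀ zz, AEStronglyMeasurable (F zz) volume := fun zz =>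
    (hchar_cont zz.2).aestronglyMeasurable.mul (hWt_meas zz.1)
  have hF'_meas : ∀ zz, AEStronglyMeasurable (F' zz) volume := by
    intro zz
    simp only [hF', synthDerivCLM]
    refine AEStronglyMeasurable.add ?_ ?_
    · have hsm : Continuous fun w : ℂ => (ContinuousLinearMap.fst ℝ ℝ (EuclideanSpace ℝ ι)).smulRight w :=
        (ContinuousLinearMap.smulRightL ℝ (ℝ × EuclideanSpace ℝ ι) ℂ
          (ContinuousLinearMap.fst ℝ ℝ (EuclideanSpace ℝ ι))).continuous
      exact hsm.comp_aestronglyMeasurable ((hchar_cont zz.2).aestronglyMeasurable.mul (hWt'_meas zz.1))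
    · exact (hWt_meas zz.1).smul (((ContinuousLinearMap.compL ℝ (ℝ × EuclideanSpace ℝ ι)
        (EuclideanSpace ℝ ι) ℂ).flip (ContinuousLinearMap.snd ℝ ℝ (EuclideanSpace ℝ ι))).continuous.comp
          (continuous_charDeriv zz.2)).aestronglyMeasurable
  -- integrability at `z`
  have hFz : F z = fun ξ => (𝐞 (-⟪ξ, z.2⟫) : ℂ) * W 0 z.1 ξ := by
    funext ξ; simp only [hF, hWt, icExtend_of_mem ht₀]
  have hF_int : Integrable (F z) := by
    rw [hFz]
    refine (hW.integrable hm h0 ht₀).norm.mono'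
      (hF_meas z |>.congr (Eventually.of_forall fun ξ => by simp only [hFz])) ?_
    exact Eventually.of_forall fun ξ => by rw [norm_mul, Circle.norm_coe, one_mul]
  -- the dominating function on the unit ball around `z`
  set bound : EuclideanSpace ℝ ι → ℝ := fun ξ => b₁ ξ + 2 * π * (b₀' ξ + b₁' ξ) with hbound
  have hbound_int : Integrable bound := hb₁.add ((hb₀'.add hb₁').const_mul _)
  have h_bound : ∀ᵐ ξ ∂volume, ∀ zz ∈ Metric.ball z 1, ‖F' zz ξ‖ ≤ bound ξ := by
    refine Eventually.of_forall fun ξ zz hzz => ?_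
    have hcl := clamp_mem_Icc hT.le zz.1
    have hdt : |zz.1 - clamp T zz.1| ≤ 1 := by
      refine (abs_sub_clamp_le hT.le ht₀).trans ?_
      have : dist zz.1 z.1 ≤ dist zz z := by
        rw [dist_eq_norm, dist_eq_norm]
        exact norm_fst_le (zz - z)
      rw [Real.dist_eq] at this
      exact this.trans (Metric.mem_ball.1 hzz).le
    -- bounds on `Wt`, `Wt'`
    have hWt'_le : ‖Wt' zz.1 ξ‖ ≤ b₁ ξ := by
      have h := hb₁d _ hcl ξ
      rwa [pow_zero, one_mul] at h
    have hWt_le : ‖ξ‖ * ‖Wt zz.1 ξ‖ ≤ b₀' ξ + b₁' ξ := by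
      have e1 : ‖Wt zz.1 ξ‖ ≤ ‖W 0 (clamp T zz.1) ξ‖ + ‖W 1 (clamp T zz.1) ξ‖ := by
        change ‖W 0 (clamp T zz.1) ξ + (zz.1 - clamp T zz.1) • W 1 (clamp T zz.1) ξ‖ ≤ _
        refine (norm_add_le _ _).trans (add_le_add le_rfl ?_)
        rw [norm_smul, Real.norm_eq_abs]
        exact mul_le_of_le_one_left (norm_nonneg _) hdt
      have hρ : ‖ξ‖ ≤ (1 + ‖ξ‖) ^ 1 := by rw [pow_one]; linarith [norm_nonneg ξ]
      have e2 : ‖ξ‖ * ‖W 0 (clamp T zz.1) ξ‖ ≤ b₀' ξ :=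
        (mul_le_mul_of_nonneg_right hρ (norm_nonneg _)).trans (hb₀'d _ hcl ξ)
      have e3 : ‖ξ‖ * ‖W 1 (clamp T zz.1) ξ‖ ≤ b₁' ξ :=
        (mul_le_mul_of_nonneg_right hρ (norm_nonneg _)).trans (hb₁'d _ hcl ξ)
      calc ‖ξ‖ * ‖Wt zz.1 ξ‖ ≤ ‖ξ‖ * (‖W 0 (clamp T zz.1) ξ‖ + ‖W 1 (clamp T zz.1) ξ‖) :=
            mul_le_mul_of_nonneg_left e1 (norm_nonneg _)
        _ = ‖ξ‖ * ‖W 0 (clamp T zz.1) ξ‖ + ‖ξ‖ * ‖W 1 (clamp T zz.1) ξ‖ := by ring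
        _ ≤ b₀' ξ + b₁' ξ := add_le_add e2 e3
    calc ‖F' zz ξ‖ ≤ ‖Wt' zz.1 ξ‖ + 2 * π * ‖ξ‖ * ‖Wt zz.1 ξ‖ :=
          norm_synthDerivCLM_le (Circle.norm_coe _) ξ zz.2
      _ = ‖Wt' zz.1 ξ‖ + 2 * π * (‖ξ‖ * ‖Wt zz.1 ξ‖) := by ring
      _ ≤ b₁ ξ + 2 * π * (b₀' ξ + b₁' ξ) := by gcongr
  -- differentiate under the integral sign
  have hmain := hasFDerivAt_integral_of_dominated_of_fderiv_le (μ := (volume : Measure (EuclideanSpace ℝ ι)))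
    (F := F) (F' := F') (x₀ := z) (s := Metric.ball z 1) (Metric.ball_mem_nhds z one_pos)
    (Eventually.of_forall hF_meas) hF_int (hF'_meas z) h_bound hbound_int
    (Eventually.of_forall fun ξ zz _ => hF_diff ξ zz)
  -- integrability of `F' z` and evaluation of the derivative
  have hF'_int : Integrable (F' z) :=
    hbound_int.mono' (hF'_meas z) (h_bound.mono fun ξ hξ => hξ z (Metric.mem_ball_self one_pos))
  refine ⟨∫ ξ, F' z ξ, ?_, fun y => ?_⟩
  · -- restrict to the slab, where `∫ F zz = synth W zz`
    refine hmain.hasFDerivWithinAt.congr (fun zz hzz => ?_) ?_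
    · rw [synth_eq]
      refine integral_congr_ae (Eventually.of_forall fun ξ => ?_)
      simp only [hF, hWt, icExtend_of_mem (show zz.1 ∈ Icc 0 T from hzz.1), Circle.smul_def,
        smul_eq_mul]
    · rw [synth_eq]
      refine integral_congr_ae (Eventually.of_forall fun ξ => ?_)
      simp only [hF, hWt, icExtend_of_mem ht₀, Circle.smul_def, smul_eq_mul]
  · rw [ContinuousLinearMap.integral_apply hF'_int y, synth_eq, synth_eq]
    have hWt_z : ∀ ξ, Wt z.1 ξ = W 0 z.1 ξ := fun ξ => by simp only [hWt, icExtend_of_mem ht₀]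
    have hWt'_z : ∀ ξ, Wt' z.1 ξ = W 1 z.1 ξ := fun ξ => by simp only [hWt', clamp_of_mem ht₀]
    have hi1 : Integrable fun ξ => 𝐞 (-⟪ξ, z.2⟫) • W (0 + 1) z.1 ξ := by
      refine (hW.integrable hm h1 ht₀).norm.mono'
        ((hchar_cont z.2).aestronglyMeasurable.smul (hW.meas 1 h1 z.1 ht₀)) ?_
      exact Eventually.of_forall fun ξ => by rw [Circle.norm_smul]
    have hdm := hW.dmul y.2
    have hi2 : Integrable fun ξ => 𝐞 (-⟪ξ, z.2⟫) • FourierNS.dmul y.2 W 0 z.1 ξ := by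
      refine (hdm.integrable hm h0 ht₀).norm.mono'
        ((hchar_cont z.2).aestronglyMeasurable.smul (hdm.meas 0 h0 z.1 ht₀)) ?_
      exact Eventually.of_forall fun ξ => by rw [Circle.norm_smul]
    rw [← integral_const_mul, ← integral_add (hi1.const_mul _) hi2]
    refine integral_congr_ae (Eventually.of_forall fun ξ => ?_)
    simp only [hF', synthDerivCLM_apply, hWt_z, hWt'_z, charDeriv_apply, FourierNS.dmul,
      Circle.smul_def, smul_eq_mul, zero_add]
    ring

/-- The directional derivatives within the slab are synthesized fields:
`fderivWithin (synth W) slab z y = y.1 • synth (W₁, …) z + synth (dmul y.2 W) z`. [folklore] -/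
theorem fderivWithin_synth_apply {m : ℕ} (hm : Module.finrank ℝ (EuclideanSpace ℝ ι) < 2 * m)
    (hT : 0 < T) (hW : IsDomFourierFamily T (n + 1) W)
    {z : ℝ × EuclideanSpace ℝ ι} (hz : z ∈ Icc 0 T ×ˢ univ) (y : ℝ × EuclideanSpace ℝ ι) :
    fderivWithin ℝ (synth W) (Icc 0 T ×ˢ univ) z y =
      (y.1 : ℂ) * synth (fun k => W (k + 1)) z + synth (FourierNS.dmul y.2 W) z := by
  obtain ⟨L, hL, hLy⟩ := hW.hasFDerivWithinAt_synth hm hT hz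
  rw [hL.fderivWithin (uniqueDiffOn_slab hT z hz), hLy]

/-- Differentiability of the synthesized field on the slab for dominated families of order
`≥ 1`. [folklore] -/
theorem differentiableOn_synth {m : ℕ} (hm : Module.finrank ℝ (EuclideanSpace ℝ ι) < 2 * m)
    (hT : 0 < T) (hW : IsDomFourierFamily T (n + 1) W) :
    DifferentiableOn ℝ (synth W) (Icc 0 T ×ˢ univ) := fun _ hz =>
  (hW.hasFDerivWithinAt_synth hm hT hz).choose_spec.1.differentiableWithinAt

/-- **Joint `C^n` smoothness of the synthesized field on the closed slab**, for every dominated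
family of order `n` (induction on `n`; the derivatives are synthesized fields of the shifted and
symbol-multiplied families). [folklore] -/
theorem contDiffOn_synth {m : ℕ} (hm : Module.finrank ℝ (EuclideanSpace ℝ ι) < 2 * m) (hT : 0 < T) :
    ∀ (n : ℕ) (W : ℕ → ℝ → EuclideanSpace ℝ ι → ℂ), IsDomFourierFamily T n W →
      ContDiffOn ℝ n (synth W) (Icc 0 T ×ˢ univ) := by
  intro n
  induction n with
  | zero =>
    intro W hW
    rw [Nat.cast_zero, contDiffOn_zero]
    exact hW.continuousOn_synth hm
  | succ n ih =>
    intro W hW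
    rw [Nat.cast_succ]
    refine contDiffOn_succ_of_fderiv_apply (hW.differentiableOn_synth hm hT) (fun h => ?_) fun y => ?_
    · exact absurd h (by simp)
    · have h1 : ContDiffOn ℝ n (synth (fun k => W (k + 1))) (Icc 0 T ×ˢ univ) := ih _ hW.shift
      have h2 : ContDiffOn ℝ n (synth (FourierNS.dmul y.2 W)) (Icc 0 T ×ˢ univ) :=
        ih _ ((hW.dmul y.2).mono (Nat.le_succ n))
      have h3 : ContDiffOn ℝ n (fun z => (y.1 : ℂ) * synth (fun k => W (k + 1)) z +
          synth (FourierNS.dmul y.2 W) z) (Icc 0 T ×ˢ univ) := (contDiffOn_const.mul h1).add h2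
      exact h3.congr fun z hz => hW.fderivWithin_synth_apply hm hT hz y

/-- **`C^∞` smoothness**: if `W₀` is the zeroth member of a dominated family of every order,
then `(t, x) ↦ 𝓕 (W₀ t) x` is `C^∞` on the closed slab (dimension `< 2m`). [folklore] -/
theorem contDiffOn_synth_infty {m : ℕ} (hm : Module.finrank ℝ (EuclideanSpace ℝ ι) < 2 * m)
    (hT : 0 < T) {W₀ : ℝ → EuclideanSpace ℝ ι → ℂ}
    (hall : ∀ n : ℕ, ∃ W : ℕ → ℝ → EuclideanSpace ℝ ι → ℂ, W 0 = W₀ ∧ IsDomFourierFamily T n W) :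
    ContDiffOn ℝ ∞ (fun z : ℝ × EuclideanSpace ℝ ι => 𝓕 (W₀ z.1) z.2) (Icc 0 T ×ˢ univ) := by
  rw [contDiffOn_infty]
  intro n
  obtain ⟨W, hW0, hW⟩ := hall n
  have h1 := contDiffOn_synth hm hT n W hW
  have h2 : synth W = fun z : ℝ × EuclideanSpace ℝ ι => 𝓕 (W₀ z.1) z.2 := by
    funext z; rw [synth, hW0]
  rw [h2] at h1
  exact h1

/-- **The time derivative within `[0, T]`** of the synthesized field of a dominated family at a
fixed point `x`: `∂ₜ synth W (t, x) = synth (W₁, …) (t, x)`. [folklore] -/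
theorem hasDerivWithinAt_synth_time {m : ℕ} (hm : Module.finrank ℝ (EuclideanSpace ℝ ι) < 2 * m)
    (hT : 0 < T) (hW : IsDomFourierFamily T (n + 1) W)
    (x : EuclideanSpace ℝ ι) {t : ℝ} (ht : t ∈ Icc 0 T) :
    HasDerivWithinAt (fun s => synth W (s, x)) (synth (fun k => W (k + 1)) (t, x)) (Icc 0 T) t := by
  have hz : ((t, x) : ℝ × EuclideanSpace ℝ ι) ∈ Icc 0 T ×ˢ (univ : Set (EuclideanSpace ℝ ι)) :=
    mk_mem_prod ht (mem_univ x)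
  obtain ⟨L, hL, hLy⟩ := hW.hasFDerivWithinAt_synth hm hT hz
  have hγ : HasDerivWithinAt (fun s : ℝ => ((s, x) : ℝ × EuclideanSpace ℝ ι))
      ((1, 0) : ℝ × EuclideanSpace ℝ ι) (Icc 0 T) t :=
    (hasDerivWithinAt_id t _).prodMk (hasDerivWithinAt_const _ _ _)
  have h := hL.comp_hasDerivWithinAt t hγ (fun s hs => mk_mem_prod hs (mem_univ _))
  have hval : L (1, 0) = synth (fun k => W (k + 1)) (t, x) := by
    rw [hLy]; simp [synth_dmul_zero]
  rw [hval] at h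
  exact h

end IsDomFourierFamily

end Literature.Analysis.FluidPDE.FourierNS

end
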